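import Summits.BirchSwinnertonDyer.Rank1Residual.Additive.X4ThreeKuriharaCertKernel
import Literature.NumberTheory.EllipticCurves.ThreeDivisionFieldSwanProofs
import HarnessLib

/-!
# N11 LOWER@3 Kurihara-certificate KERNEL TOOL, sequel: the CYCLICITY binder `#Ẽ(𝔽_ℓ)[3] ≤ 3` from
# ONE root of the `3`-division polynomial `Ψ₃` in `𝔽_ℓ` — the case `9 ∣ #Ẽ(𝔽_ℓ)` a point count cannot decide
# (cell `b2b-bsdres`, team n1011, seat p03, OWNERS row T-a2-REC; sequel of `X4ThreeKuriharaCertKernel.lean` §1)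

HONEST FRAMING (cell `b2b-bsdres`, run/shared/lean/b2b/bsd-rank1-residual/, verbatim in every
file): the goal of the cell is to DELETE the COMBINATION-SHAPED residual classes of the
Birch–Swinnerton-Dyer formula for ALL analytic-rank `≤ 1` elliptic curves over `ℚ` — "full BSD
formula for every rank `≤ 1` curve in class `C`" assembled STRICTLY from published theorems — so
that the rank-`≤ 1` remainder becomes exactly the CONSTRUCTION-SHAPED classes, which are TYPED
(missing-input `Prop`s), NOT attempted. This is not "finishing BSD". Team n1011 is a RESEARCH ROUTE;
no claim beyond the stated classes; the label X4 and the mark of RESIDUAL-MAP §I N11 (LOWER@3) are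
UNCHANGED; nothing is booked. This file is a DATA-FREE kernel tool: elementary group theory of the
points of a Weierstrass curve over a field; no named fact, no definition, no new `Prop`, no
conjecture is used or minted.

## What this file proves

Every Kurihara-number consumer at `p = 3` in the tree (`X4.KuriharaUnitAt`, p03's
`KuriharaIndexLeAt`, p17's rank-one shapes, the [K25] `_OPEN` records) carries, for each prime `ℓ` of
the Kolyvagin level `n`, the CYCLICITY binder
`Nat.card {P : Ẽ(𝔽_ℓ) // 3 • P = 0} ≤ 3` (Kim's `𝒫_{k}` requires `Ẽ(𝔽_ℓ)[3]` cyclic; Kurihara's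
`𝒫_{1,0}`).  The kernel tool `X4ThreeKuriharaCertKernel.lean` §1 discharges it from a point count when
`9 ∤ #Ẽ(𝔽_ℓ)` (`card_torsion_le_of_intModel_of_card`).  When `9 ∣ #Ẽ(𝔽_ℓ)` — e.g. BOTH primes of the
level `139·151` PRINTED for `22077e1` in Kim–Pollack App. §8.1.1 (`#Ẽ(𝔽₁₃₉) = 144`,
`#Ẽ(𝔽₁₅₁) = 171`) — the count is silent, and the records so far carried cyclicity as an ENGINE BIT
(`ellgroup`).  This file makes it a kernel certificate in that case too:

* §1 `natCard_three_torsion_le_of_psi3_roots_subsingleton` — over ANY field `K`, if the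
  `3`-division polynomial `Ψ₃ = 3x⁴ + b₂x³ + 3b₄x² + 3b₆x + b₈` of `V` has AT MOST ONE root in `K`, then
  `#{P ∈ V(K) : 3P = O} ≤ 3`.  Proof: a point `P ≠ O` with `3P = O` is affine, `P = (x, y)`, and
  `Ψ₃(x) = 0` (tree theorem `eval_divisionPolynomial_three_eq_zero_of_three_smul_eq_zero`, Silverman
  *AEC* Ex. 3.7: `P` is not `2`-torsion and `3P = O ↔ Ψ₃(x) = 0` off `E[2]`); so all such points share
  ONE `x`-coordinate, hence are `±P₀` (`Affine.Y_eq_of_X_eq`), and `{O, P₀, −P₀}` exhausts the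
  `3`-torsion.  `natCard_three_torsion_le_of_psi3_root` is the form with a named root `x₀`
  (`∀ x, Ψ₃(x) = 0 → x = x₀`), which `decide` discharges over `ZMod ℓ` in `O(ℓ)` ring operations.
* §2 `card_three_torsion_le_of_intModel_of_psi3_root` — the RECORD form: `integralModelInt W = E₀`, a
  prime `ℓ`, a natural number `x₀` and the decidable hypothesis
  `∀ x : ZMod ℓ, 3x⁴ + b̄₂x³ + 3b̄₄x² + 3b̄₆x + b̄₈ = 0 → x = x₀` (the `b̄ᵢ` of `E₀ mod ℓ`) give the binder
  in the exact shape the consumers quantify (`((integralModelInt W).map (Int.castRingHom (ZMod ℓ)))`).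
* §3 `forall_card_torsion_le_of_dvd_mul` — the level-`ℓ₁ℓ₂` dispatcher from the two per-prime bounds,
  whatever certificate produced each (point count §1 of the sibling, or `Ψ₃` here), any `p`.

COMPLETENESS ON KOLYVAGIN PRIMES (EVIDENCE remark, not used and not proved here): for `ℓ ∈ 𝒫₁(E, 3)`
(`ℓ ≡ 1`, `a_ℓ ≡ ℓ + 1 ≡ 2 (mod 3)`) the Frobenius `φ_ℓ` on `E[3]` has characteristic polynomial
`(X − 1)²`, so it is `1` (all of `E[3]` rational: `Ẽ(𝔽_ℓ)[3] ≅ (ℤ/3)²`, the four roots of `Ψ₃` in `𝔽_ℓ`)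
or a transvection (`Ẽ(𝔽_ℓ)[3] ≅ ℤ/3`; `φ_ℓ` fixes exactly one of the four lines of `E[3]`, i.e. exactly
ONE root of `Ψ₃` lies in `𝔽_ℓ`).  Hence on `𝒫₁` "exactly one root of `Ψ₃` in `𝔽_ℓ`" is EQUIVALENT to
cyclicity: the certificate of this file decides the binder on every candidate level prime, and the
records (`Additive/X4ThreeKuriharaCertRecords*.lean`, DRY-RUN until two-engine values) lose the engine
bit `hcyc` altogether — `22077e1` at the printed level `139·151` (one root each: `x₀ = 92`, `x₀ = 101`)
becomes kernel-side in everything but the Kurihara VALUE `hδ`.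

References: J. H. Silverman, *The Arithmetic of Elliptic Curves*, 2nd ed., GTM 106 (2009), III.2.3 and
Exercise 3.7 [SilvermanAEC2009]; C.-H. Kim, AJM 148 (2026) §1.2.2, Thm. 1.10 (1) (the cyclic-reduction
condition on Kolyvagin primes) [Kim2022StructureSelmer]; C.-H. Kim (app. R. Pollack), arXiv:2505.09121v1
App. §8.1.1 (the `22077` row; ANNOUNCED preprint — an example, not a source of truth) [Kim2025RefinedTNC];
cell files cells/n1011/skel/T-a2-REC.md §5 (kernel-node column), cells/n1011/PREDICTIONS-E2-AT3.md A8.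
-/

noncomputable section

open scoped Classical

open WeierstrassCurve Polynomial
  Summit.BirchSwinnertonDyer.BirchSwinnertonDyer.Rank1Residual.IntModel

namespace Summit.BirchSwinnertonDyer.Rank1Residual.Additive

/-! ### §1 At most one root of `Ψ₃` ⟹ at most three `3`-torsion points -/

section Psi3

variable {K : Type*} [Field K] (V : WeierstrassCurve K)

/-- **At most one root of `Ψ₃` in `K` ⟹ `#{P ∈ V(K) : 3P = O} ≤ 3`.**  A point `P ≠ O` killed by `3`
is affine, `P = (x, y)` with `Ψ₃(x) = 0` (`eval_divisionPolynomial_three_eq_zero_of_three_smul_eq_zero`: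
`P ∉ E[2]`, and `3P = O ↔ Ψ₃(x) = 0` off `E[2]`, Silverman Ex. 3.7); two affine points with the same `x`
are equal or opposite (`Affine.Y_eq_of_X_eq`); so the `3`-torsion is inside `{O, P₀, −P₀}` for any one
such `P₀` (and is `{O}` if there is none).  The group law on `V(K)` is Mathlib's, for an ARBITRARY
`DecidableEq K` instance (the consumers over `ZMod ℓ` use the computable one; the proof aligns it with the
classical instance of the tree lemma, all such instances being equal). [cite: SilvermanAEC2009, III.2.3 and Exercise 3.7] -/
theorem natCard_three_torsion_le_of_psi3_roots_subsingleton [hdec : DecidableEq K]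
    (hroot : ∀ x x' : K, V.Ψ₃.eval x = 0 → V.Ψ₃.eval x' = 0 → x = x') :
    Nat.card {P : V.toAffine.Point // 3 • P = 0} ≤ 3 := by
  -- align the `DecidableEq K` instance of the statement with the classical one of the tree lemma
  obtain rfl : hdec = Classical.decEq K := Subsingleton.elim _ _
  by_cases hex : ∃ P : V.toAffine.Point, P ≠ 0 ∧ 3 • P = 0
  · obtain ⟨P₀, hP₀, h3P₀⟩ := hex
    have h3neg : 3 • (-P₀) = 0 := by rw [smul_neg, h3P₀, neg_zero]
    -- the three candidates `O, P₀, -P₀`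
    let g : Fin 3 → {P : V.toAffine.Point // 3 • P = 0} :=
      ![⟨0, smul_zero _⟩, ⟨P₀, h3P₀⟩, ⟨-P₀, h3neg⟩]
    have hg : Function.Surjective g := by
      rintro ⟨P, hP⟩
      rcases P with _ | ⟨x, y, h⟩
      · exact ⟨0, by simp [g]; rfl⟩
      · rcases P₀ with _ | ⟨x₀, y₀, h₀⟩
        · exact absurd rfl hP₀
        · -- both `x` and `x₀` are roots of `Ψ₃`, hence equal
          have hx : x = x₀ := hroot x x₀
            (eval_divisionPolynomial_three_eq_zero_of_three_smul_eq_zero (by exact_mod_cast hP))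
            (eval_divisionPolynomial_three_eq_zero_of_three_smul_eq_zero (by exact_mod_cast h3P₀))
          rcases Affine.Y_eq_of_X_eq h.left h₀.left hx with hy | hy
          · refine ⟨1, Subtype.ext ?_⟩
            simp only [g, Matrix.cons_val_one]
            subst hy; subst hx; rfl
          · refine ⟨2, Subtype.ext ?_⟩
            simp only [g, Matrix.cons_val_two, Matrix.tail_cons, Matrix.head_cons,
              Affine.Point.neg_some]
            subst hx; subst hy; rfl
    simpa using Nat.card_le_card_of_surjective g hg
  · -- no non-zero `3`-torsion: the subtype is `{O}`
    push Not at hex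
    have hsub : ∀ P : {P : V.toAffine.Point // 3 • P = 0}, P = ⟨0, smul_zero _⟩ := by
      rintro ⟨P, hP⟩
      by_contra hne
      exact hex P (fun h0 => hne (Subtype.ext h0)) hP
    haveI : Subsingleton {P : V.toAffine.Point // 3 • P = 0} :=
      ⟨fun a b => by rw [hsub a, hsub b]⟩
    calc Nat.card {P : V.toAffine.Point // 3 • P = 0} ≤ 1 :=
        Finite.card_le_one_iff_subsingleton.mpr ‹_›
      _ ≤ 3 := by norm_num

/-- **Named-root form**: if every root of `Ψ₃` in `K` equals a given `x₀`, then
`#{P ∈ V(K) : 3P = O} ≤ 3` — the shape `decide` discharges over `K = ZMod ℓ` in `O(ℓ)` ring operations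
(`x₀` = the `x`-coordinate of the rational `3`-torsion when there is one; any residue otherwise).
[cite: SilvermanAEC2009, III.2.3 and Exercise 3.7] -/
theorem natCard_three_torsion_le_of_psi3_root [DecidableEq K] (x₀ : K)
    (hroot : ∀ x : K, V.Ψ₃.eval x = 0 → x = x₀) :
    Nat.card {P : V.toAffine.Point // 3 • P = 0} ≤ 3 :=
  natCard_three_torsion_le_of_psi3_roots_subsingleton V
    fun x x' hx hx' => (hroot x hx).trans (hroot x' hx').symm

/-- The value of `Ψ₃` written out: `Ψ₃(x) = 3x⁴ + b₂x³ + 3b₄x² + 3b₆x + b₈` (Mathlib's definition,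
evaluated). [cite: SilvermanAEC2009, Exercise 3.7] -/
theorem eval_psi3_eq {R : Type*} [CommRing R] (V : WeierstrassCurve R) (x : R) :
    V.Ψ₃.eval x = 3 * x ^ 4 + V.b₂ * x ^ 3 + 3 * V.b₄ * x ^ 2 + 3 * V.b₆ * x + V.b₈ := by
  simp only [WeierstrassCurve.Ψ₃, eval_add, eval_mul, eval_pow, eval_C, eval_X, eval_ofNat]

end Psi3

/-! ### §2 The record form: cyclicity of `Ẽ(𝔽_ℓ)[3]` READ OFF AN INTEGER MODEL from one root of `Ψ₃ mod ℓ` -/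

section IntModel

/-- **The cyclicity binder at `p = 3` READ OFF AN INTEGER MODEL from ONE root of `Ψ₃ mod ℓ`**:
`integralModelInt W = E₀`, a prime `ℓ`, a natural number `x₀`, and the DECIDABLE hypothesis that every
root in `ZMod ℓ` of `3x⁴ + b̄₂x³ + 3b̄₄x² + 3b̄₆x + b̄₈` (the `b̄ᵢ` of `E₀ mod ℓ`) equals `x₀ mod ℓ`, give
`#Ẽ(𝔽_ℓ)[3] ≤ 3` in the exact shape of `X4.KuriharaUnitAt` / `KuriharaIndexLeAt` / the Kim facts —
also when `9 ∣ #Ẽ(𝔽_ℓ)`, where the point-count certificate `card_torsion_le_of_intModel_of_card` is silent.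
(No good-reduction hypothesis is needed for the inequality itself; the level theorems ask `ℓ ∤ Δ`
separately.  The hypothesis is stated before the `Fact ℓ.Prime` binder and with `x₀ : ℕ`, so that its
ring operations and casts are those of `ZMod.commRing` and a record's `decide` goal is a closed term.) [cite: SilvermanAEC2009, III.2.3 and Exercise 3.7] [cite: Kim2022StructureSelmer, §1.2.2 and Thm. 1.10 (1)] -/
theorem card_three_torsion_le_of_intModel_of_psi3_root {W : WeierstrassCurve ℚ} [W.IsGloballyMinimal]
    {E₀ : WeierstrassCurve ℤ} (hI : integralModelInt W = E₀) (ℓ x₀ : ℕ)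
    -- stated BEFORE `Fact ℓ.Prime` enters and with `x₀ : ℕ`: plain `ZMod ℓ` ring operations and casts,
    -- so that a record's instance of this hypothesis is a CLOSED `decide` goal
    (hroot : ∀ x : ZMod ℓ,
      3 * x ^ 4 + (E₀.map (Int.castRingHom (ZMod ℓ))).b₂ * x ^ 3 +
          3 * (E₀.map (Int.castRingHom (ZMod ℓ))).b₄ * x ^ 2 +
          3 * (E₀.map (Int.castRingHom (ZMod ℓ))).b₆ * x +
          (E₀.map (Int.castRingHom (ZMod ℓ))).b₈ = 0 → x = (x₀ : ZMod ℓ)) [Fact ℓ.Prime] :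
    Nat.card {P : ((WeierstrassCurve.integralModelInt W).map
        (Int.castRingHom (ZMod ℓ))).toAffine.Point // 3 • P = 0} ≤ 3 := by
  subst hI
  refine natCard_three_torsion_le_of_psi3_root _ (x₀ : ZMod ℓ) fun x hx => hroot x ?_
  rw [← eval_psi3_eq]
  exact hx

end IntModel

/-! ### §3 The level dispatcher from two per-prime cyclicity bounds -/

section Dispatch

/-- **Cyclicity at every prime factor of `ℓ₁ℓ₂` from the two per-prime bounds**, whatever certificate
produced each of them (the point count `card_torsion_le_of_intModel_of_card` when `p² ∤ #Ẽ(𝔽_ℓ)`, or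
`card_three_torsion_le_of_intModel_of_psi3_root` at `p = 3` in general) — the `hcyc` binder of
`kuriharaUnitAt_of_level` / `kuriharaIndexLeAt_of_level` at the level `n = ℓ₁ℓ₂`.
[cite: Kim2022StructureSelmer, §1.2.2 and Thm. 1.10 (1)] -/
theorem forall_card_torsion_le_of_dvd_mul {W : WeierstrassCurve ℚ} [W.IsGloballyMinimal]
    (p ℓ₁ ℓ₂ : ℕ) [Fact ℓ₁.Prime] [Fact ℓ₂.Prime]
    (h₁ : Nat.card {P : ((WeierstrassCurve.integralModelInt W).map
        (Int.castRingHom (ZMod ℓ₁))).toAffine.Point // p • P = 0} ≤ p)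
    (h₂ : Nat.card {P : ((WeierstrassCurve.integralModelInt W).map
        (Int.castRingHom (ZMod ℓ₂))).toAffine.Point // p • P = 0} ≤ p) :
    ∀ (ℓ : ℕ) [Fact ℓ.Prime], ℓ ∣ ℓ₁ * ℓ₂ →
      Nat.card {P : ((WeierstrassCurve.integralModelInt W).map
          (Int.castRingHom (ZMod ℓ))).toAffine.Point // p • P = 0} ≤ p := by
  intro ℓ hℓ hdvd
  rcases (Nat.Prime.dvd_mul hℓ.out).mp hdvd with hd | hd
  · obtain rfl := (Nat.prime_dvd_prime_iff_eq hℓ.out Fact.out).mp hd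
    exact h₁
  · obtain rfl := (Nat.prime_dvd_prime_iff_eq hℓ.out Fact.out).mp hd
    exact h₂

/-- **Single-prime level**: cyclicity at every prime factor of a prime level `ℓ₁` from the one bound.
[cite: Kim2022StructureSelmer, §1.2.2 and Thm. 1.10 (1)] -/
theorem forall_card_torsion_le_of_dvd_prime {W : WeierstrassCurve ℚ} [W.IsGloballyMinimal]
    (p ℓ₁ : ℕ) [Fact ℓ₁.Prime]
    (h₁ : Nat.card {P : ((WeierstrassCurve.integralModelInt W).map
        (Int.castRingHom (ZMod ℓ₁))).toAffine.Point // p • P = 0} ≤ p) :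
    ∀ (ℓ : ℕ) [Fact ℓ.Prime], ℓ ∣ ℓ₁ →
      Nat.card {P : ((WeierstrassCurve.integralModelInt W).map
          (Int.castRingHom (ZMod ℓ))).toAffine.Point // p • P = 0} ≤ p := by
  intro ℓ hℓ hdvd
  obtain rfl := (Nat.prime_dvd_prime_iff_eq hℓ.out Fact.out).mp hdvd
  exact h₁

end Dispatch

end Summit.BirchSwinnertonDyer.Rank1Residual.Additive

end
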